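import Mathlib
import Literature.Computability.Complexity.StackMachinesTM2
import Literature.Computability.Complexity.TokenStreams
import HarnessLib

/-!
# `UniformStreamLB` (route UniformStream, item stmt-PneNP-16045), line `Birth` — stub `stub_incrementer`

One Boolean `TM2` machine (Mathlib's `Turing.FinTM2`, bundled as `Turing.TM2ComputableAux Bool Bool`)
maps the binary numeral `encodeNat n` (least significant bit first, `Computability.encodeNat`) to
`encodeNat (n + 1)` within `10 · |encodeNat n| + 10` steps.

Proof: the tree's structured stack program `TokConv.inc` (`TokenStreams.lean`; a carry pass over
the counter register [Knuth 1998, §4.3.1]) replaces `encodeNat n` by `encodeNat (n + 1)` in its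
register `ctr`, all other registers staying empty, at cost `≤ 9 |encodeNat n| + 9`
(`TokConv.runs_inc`); the step-for-step compilation of stack programs to `TM2` machines
(`Com.outputsWithin_of_runs_equiv`, `StackMachinesTM2.lean` [Minsky 1967, §11.1, §14.1;
Arora–Barak 2009, §1.2–1.3]) with input stack = output stack = `ctr` turns this run into a
machine run of at most one more step.

## References

* D. E. Knuth, *The Art of Computer Programming*, Vol. 2, 3rd ed. 1998, §4.3.1 (binary increment
  with carry propagation).
* S. Arora, B. Barak, *Computational Complexity: A Modern Approach*, CUP 2009, §1.2–1.3
  (multi-tape machines, running time, machines as subroutines).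
-/

set_option linter.dupNamespace false -- `Summit.PneNP.PneNP.…`: summit = sub-problem (D-0017)

noncomputable section

namespace Summit.PneNP.PneNP.Theorems.UniformStreamLB.Birth

open Literature.Computability.Complexity _root_.Computability

/-- The register file "`z` in the counter register `ctr`, all else empty" over the converter
registers `TokConv.CReg` is `TokConv.cfile [] z [] [] [] []`. [folklore] -/
theorem init_ctr_eq (z : List Bool) :
    Regs.init TokConv.CReg.ctr z = TokConv.cfile [] z [] [] [] [] := by
  funext x; cases x <;> rfl

/-- **Stub B (binary incrementer).** One Boolean `TM2` machine maps the binary numeral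
`encodeNat n` (least significant bit first) to `encodeNat (n + 1)` in linear time
(`10 |encodeNat n| + 10` steps): the carry-pass stack program `TokConv.inc` compiled step for
step to a `TM2` machine whose input and output stack is the counter register.
[Knuth 1998, §4.3.1; Arora–Barak 2009, §1.3] [folklore] -/
theorem stub_incrementer :
    ∃ (M : Turing.TM2ComputableAux Bool Bool) (d : ℕ),
      ∀ n : ℕ, M.OutputsWithin (Computability.encodeNat n) (Computability.encodeNat (n + 1))
        (d * (Computability.encodeNat n).length + d) := by
  refine ⟨(Com.compile (TokConv.inc.map (Fintype.equivFin TokConv.CReg))).toAux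
      (Fintype.equivFin TokConv.CReg .ctr) (Fintype.equivFin TokConv.CReg .ctr), 10, fun n => ?_⟩
  have h := TokConv.runs_inc n [] [] []
  rw [← init_ctr_eq, ← init_ctr_eq] at h
  exact (Com.outputsWithin_of_runs_equiv (Fintype.equivFin TokConv.CReg) (Or.inl h)).mono
    (by omega)

end Summit.PneNP.PneNP.Theorems.UniformStreamLB.Birth
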